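import Summits.QuantumFields.BalabanUV.Beta.CombRemainderTadpoleSlot
import Summits.QuantumFields.BalabanUV.Beta.CombSecondOrderDeltaSepScaled

/-!
# `BalabanUV.Beta.CombRemainderTadpoleSlotScaled` — binder row D1, the (III″) κ-TWIN CHAIN (an2 W-3 l.63100 programme P5, brick P5-a-κ): **THE REPAIR
# TRACK's SCALAR `hRm0` REDUCES TO THE T2-REMAINDER SLOT — FOR THE κ-LITERAL, EVERY GROUP WEIGHT `w`**

WHY (an2 RULING R-D1-g56-4 (4-2), W-3 l.63100 (S)∕(D5)∕(D6), W-5 + CORRECTION C-an2-g56-2 l.63171, RCPT-4∕R5 l.63155 (the literal ACCEPTED BY VALUE at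
w = Lc¹²∕4: Engine C `prestab/atk/ATK.md` ea54d781657b45d1, leaf-01 R-2 l.63194); leaf-01 g42 N-1 l.63157 (`CENSUS-DEFCONE-g42.md` — the def-buried segment);
leaf-03 g50 O-g50-1 l.63160 P1–P4): the (III″) literal is ROOT M‴'s literal with its Λ GROUP at the group weight `w` (the programme's `κ`; `κ` is a bound
bond index here): mixed table `w • symMixFFAt ρ_c Lc`, multiplier ∕ first-order Λ pin `w·cΛ`, mixed reflection remainder `w • symRMrAn1 Lc cΛ γ`,
the BASE lock `hΛ : cΛ·Lc⁴ = 2` kept VERBATIM; its second-order remainder ∕ split defect are leaf-03 g50's slotted re-definitions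
`CombSecondOrderRemainderAn1Scaled.combR2An1W ∕ combΔAn1W` (NOT `w •` the landed ones).  THIS FILE re-runs an2 gen 38's `CombRemainderTadpoleSlot` §2 + §5 over
them, summand by summand: of the four words of the κ-literal's W-remainder (leaf-03's `combΔOfAtW_eq_sharp`), the contact mismatch and the contact-kernel
vertex are the parent's words at the pin `w·cΛ` (the parent's §3∕§4 are pin-GENERIC — consumed BY NAME), and the mixed remainder slot is `w •` an2-g31's
`symRMrAn1`, row-parity-odd at the SAME base weight lock `cΛ·wM1_j·γ_j = −wM2_j` (the parent's `trK_symRMrAn1` + `parityOdd_smul`; class by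
leaf-03 g50's `CombSecondOrderClassScaled.locStencilFM_smul_symRMrAn1`) — so three words have zero tadpole against `G′_j = GcombSh Lc j` and `hRm0` for the κ-literal follows from the
T2-remainder slot identity `hR2tad` read on leaf-03's `combR2An1W`, VERBATIM as in the parent.  In the one-κ currency the weight lock the cancellation
needs is the BASE lock × w — no `weightLock`, no `w ≠ 0`, `w` FREE.  [folklore] kernel algebra BY NAME; nothing of an1's ∕ an2's ∕ leaf-03's ∕ leaf-05's restated.
WHAT: §1 `tadpole_mixOfK_smul_symRMrAn1_eq_zero` (class by leaf-03 g50's `CombSecondOrderClassScaled.locStencilFM_smul_symRMrAn1`); §2 **`tadpole_combΔAn1W_pinned_eq`**, **`tadpole_RmW_pinned_eq`**, **`hRm0W_of_hR2tad`**.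
The parent's §6 root variant is NOT twinned (off M‴'s cone, leaf-04 census A2).  At `w = 1` every statement is the parent's (`…Scaled.…W_one`).
WHAT THIS IS NOT: no VALUE of `w`; no binder of the row discharged (0∕4: hW, hR, D1Tel, D1Rep); a REDUCTION of the κ-literal's displayed scalar, exactly as
the parent is for w = 1; ROOT M‴ p325680 and the root of record untouched; NOT D1, NEVER «G-an2-4 closed», NOT BetaPertH, NOT continuum, NOT Clay.

HONEST DEPENDENCY (page 1, mandatory): continuum YM on T⁴ ⇐ BetaPertH ∧ nine spine estimates (0/9 proved); BetaPertH ⇐ (D1) ∧ (D4) ∧ CAP+tail;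
G-an2-4 gates asym, D1 and NE2/3/4.  DERIVED cell leaf ([folklore] BY NAME; β sub-cell, D1 formalisation swarm leaf prover 01 (`b2b-balaban-beta-d1-formalise-leaf-01`
gen 42), 2026-08-25 (v1); INTENT I-leaf01-g42-1 «P5-κ» l.63217); over an2 gen 38's `CombRemainderTadpoleSlot` (§1–§5 lemmas BY NAME), leaf-03 g50's
`CombSecondOrderRemainderAn1Scaled` ∕ `CombSecondOrderClassScaled` ∕ `CombSecondOrderDeltaSepScaled`; no statement of Bałaban's papers,
no `[cite:]`, no `Prop` fact, no `def`; no existing file touched.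
-/

noncomputable section

open Finset
open scoped BigOperators
open Literature.MathematicalPhysics.QuantumFieldTheory
open Literature.MathematicalPhysics.QuantumFieldTheory.Balaban1983to89
open Literature.MathematicalPhysics.QuantumFieldTheory.Balaban1983to89.Beta
open B12Sec2to5 (l1 l1_nonneg)
open ExpKernelCalculus (MKer Decays BiLoc VertexFamily comp tr tadpole)
open PolarizationSign (reflSign)
open KernelReflection (refK)
open ResolventReflection (bref Φ)
open AveragingContoursRooted (ctr ctrOff ctrOff_mem_box)
open Literature.MathematicalPhysics.QuantumFieldTheory.Balaban1983to89.Beta.VectorTailsLoc (fam kfam)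
open Literature.MathematicalPhysics.QuantumFieldTheory.Balaban1983to89.Beta.VectorLegVolumeAdapter (MvE)
open OneStepResolventKernel (Fib LocStencil JetData decays_mono)
open OneStepKernelFamily (D1Tel D1Rep D1Drift)
open OneStepKernelFamily (colH vertexOfK)
open BalabanStepJetsSucc (wVH)
open BalabanStepW2 (M2Of wM1 wM2 wV4)
open BalabanCompositeJets (LocStencil₂)
open SecondOrderResponse (dM K2OfK vertex2OfK mixOfK W2OfK LocStencilFM)
open WilsonVertex2Sym (wsym22)
open Summit.QuantumFields.BalabanUV.Beta.TameKernelCalculus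
open Summit.QuantumFields.BalabanUV.Beta.ChartConjugation (conjV conjW conjW₁ conjW₂ loc_conjV)
open Summit.QuantumFields.BalabanUV.Beta.KernelWardRelative (conjV_zero)
open Summit.QuantumFields.BalabanUV.Beta.SecondOrderSplitLoc (loc_dM_Xi_dressed)
open Summit.QuantumFields.BalabanUV.Beta.SecondOrderSeparationCalculus (sep_vertex2OfK sep_mixOfK sep_mixOfK_swap)
open Summit.QuantumFields.BalabanUV.Beta.SymSecondOrderClassStep (pkg_of_spr)
open Summit.QuantumFields.BalabanUV.Beta.CombSecondOrderDeltaSep (hΔL_pinned)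
open KernelReflection (tadpole_smul)
open Summit.QuantumFields.BalabanUV.Beta.ChartConjugationRelative (RelInv trace_KHY_rel trace_KYH_rel)
open Summit.QuantumFields.BalabanUV.Beta.AxialDressingRooted (one_le_of_neZero axEc spr_axEc)
open Summit.QuantumFields.BalabanUV.Beta.SymShiftedSpread (bhKStepSh spr_bhKStepSh)
open Summit.QuantumFields.BalabanUV.Beta.BorderedHessian (sgnK sgnK_apply sgnF sgnF_inl sgnF_inr bhK spr_bhK stepScale diagK diagK_apply comp_diagK_left comp_diagK_right
  conjV_diagK_apply comp_axEc_diagK_comm ctGen ctGen_inl)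
open Summit.QuantumFields.BalabanUV.Beta.SymSecondOrderSplitLoc (locStencil₂_diagK_ctGenM_mul_ctGenM)
open Summit.QuantumFields.BalabanUV.Beta.E3ContactGenerator (ctGenM ctGenM_inl)
open Summit.QuantumFields.BalabanUV.Beta.DshAn1 (Dsh spr_Dsh)
open Summit.QuantumFields.BalabanUV.Beta.RelInvNullShift (spr_add)
open Summit.QuantumFields.BalabanUV.Beta.SpineRooted (M1Of_apply)
open Summit.QuantumFields.BalabanUV.Beta.SymAveragingHessianCounts (symVhSAt symHessFFAt symLinKerAt symVhSAt_hV_ctr symHessFFAt_hH_ctr)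
open Summit.QuantumFields.BalabanUV.Beta.SymAveragingMixedJetTables (symMixFFAt)
open Summit.QuantumFields.BalabanUV.Beta.SymSecondOrderTablesAn1 (symVh₂SAn1 symTablesAn1S2)
open Summit.QuantumFields.BalabanUV.Beta.CombChartJointEnd (JsB12CombShSym)
open Summit.QuantumFields.BalabanUV.Beta.CombChartJointEndReflTablesAn1S2N (d1Drift_JsB12CombShSym_an1TablesS2_pinned_of_locks_hcomp_D1Tel_D1Rep)
open Summit.QuantumFields.BalabanUV.Beta.SymMixedReflectionLetterAn1 (symRMrAn1)
open Summit.QuantumFields.BalabanUV.Beta.SymMixedRemainderClass (locStencilFM_symRMrAn1)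
open Summit.QuantumFields.BalabanUV.Beta.SymTablesAn1FirstOrder (trK_symVhSAt trK_symHessFFAt trK_M1Of_symHessFFAt)
open Summit.QuantumFields.BalabanUV.Beta.SymmetrisedStepJetsParity (trK_SpureRecOf)
open Summit.QuantumFields.BalabanUV.Beta.SpineRecursiveParity (parityOdd_smul tadpole_dM_eq_zero_of_rows)
open Summit.QuantumFields.BalabanUV.Beta.SecondOrderRemainderTables (tadpole_mixOfK_eq_zero loc_vertex2OfK loc_mixOfK)
open Summit.QuantumFields.BalabanUV.Beta.CombChartStepJets (GcombSh decays_GcombSh)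
open Summit.QuantumFields.BalabanUV.Beta.CombChartWardSockets (trK_GcombSh)
open Summit.QuantumFields.BalabanUV.Beta.CombChartContactFactor (spr_GcombSh)
open Summit.QuantumFields.BalabanUV.Beta.RelInvCombShiftedSpread (relInv_coDressKAt_Gsym_bhKStepSh)
open Summit.QuantumFields.BalabanUV.Beta.SpineRooted (M1Of SpureRecOf T2RecOf)
open Summit.QuantumFields.BalabanUV.Beta.CombSecondOrderRemainderAn1 (combΔOfAt combR2An1 combΔAn1)
open Summit.QuantumFields.BalabanUV.Beta.CombSecondOrderDeltaSep (comb_letters_common combΔOfAt_eq_sharp locStencil₂_combR2An1)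
open Summit.QuantumFields.BalabanUV.Beta.SymSecondOrderDeltaSep (sep_diagK_sharpSymbol sep_zeroTable)
open Summit.QuantumFields.BalabanUV.Beta.CombRemainderTadpoleSlot (symRMrAn1_apply trK_symRMrAn1 tadpole_conjV_bhKStepSh_eq_zero tadpole_conjV_bhKStepSh_diagK_eq_zero
  tadpole_dM_SpureRecOf_eq_zero conjW_sub_conjW diagK_zeroTable diagK_zeroTable_sub lock_of_hΛ)
open Summit.QuantumFields.BalabanUV.Beta.CombSecondOrderRemainderAn1Scaled (combΔOfAtW combR2An1W combΔAn1W)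
open Summit.QuantumFields.BalabanUV.Beta.CombSecondOrderDeltaSepScaled (combΔOfAtW_eq_sharp locStencil₂_combR2An1W hΔL_pinnedW)
open Summit.QuantumFields.BalabanUV.Beta.CombSecondOrderClassScaled (locStencilFM_smul_symRMrAn1)

namespace Summit.QuantumFields.BalabanUV.Beta.CombRemainderTadpoleSlotScaled

variable {Lc : ℕ} [NeZero Lc]

/-! ## §1 The SCALED mixed-remainder slot has zero tadpole against the comb-chart resolvent -/

/-- [folklore] **THE SCALED MIXED-SLOT WORD HAS ZERO TADPOLE AGAINST `G′_j`** at the BASE weight lock `cΛ·wM1_j·γ_j = −wM2_j`, every `w`: the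
parent's `tadpole_mixOfK_symRMrAn1_eq_zero` re-run with leaf-03 g50's class `CombSecondOrderClassScaled.locStencilFM_smul_symRMrAn1` and the row parity `parityOdd_smul w (trK_symRMrAn1 hw …)` (leaf-05's
`SecondOrderRemainderTables.tadpole_mixOfK_eq_zero`; `spr_GcombSh`, `trK_GcombSh`, `decays_GcombSh`). -/
theorem tadpole_mixOfK_smul_symRMrAn1_eq_zero {cΛ : ℝ} {γ : ℕ → ℝ} {j : ℕ} (hw : cΛ * wM1 3 Lc j * γ j = -wM2 3 Lc j) (w : ℝ) (α μ : Fin 4)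
    (y : Fin 4 → ℤ) (ν : Fin 4) (y' : Fin 4 → ℤ) :
    tadpole (GcombSh Lc j) (mixOfK (GcombSh (d := 3) Lc j) Lc (fun κ u ρ t => w • symRMrAn1 Lc cΛ γ j α κ u ρ t) μ y ν y') = 0 := by
  obtain ⟨δ, C, hδ, hC, hG⟩ := decays_GcombSh (d := 3) Lc j
  obtain ⟨CM, δM, hδM, hRM⟩ := locStencilFM_smul_symRMrAn1 (Lc := Lc) w cΛ γ j α
  have hm : 0 < min δ δM := lt_min hδ hδM
  exact tadpole_mixOfK_eq_zero (spr_GcombSh (d := 3) (Lc := Lc) j) (trK_GcombSh (d := 3) (Lc := Lc) j)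
    (decays_mono hG hC le_rfl (min_le_left _ _)) hC hm (hRM.mono (min_le_right _ _)) (fun κ u ρ t => parityOdd_smul w (trK_symRMrAn1 hw α κ u ρ t)) μ y ν y'

/-! ## §2 The reduction: `tadpole G′_j (combΔAn1W …) = tadpole G′_j (T2-remainder slot)`, and the κ-literal's `hRm0` from the slot identity alone -/

/-- [folklore] **THE REDUCTION AT THE PIN `X2s := 0`, FOR THE κ-LITERAL (every group weight `w`)**: at the weight lock, for every `N`, level `j`, axis `α` and bond pair,
`tadpole G′_j (combΔAn1W … 0 j α μ y ν y′) = tadpole G′_j (vertex2OfK G′_j Lc (combR2An1W … 0 j α) μ y ν y′)` — the contact mismatch (the parent's §3), the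
contact-kernel vertex (the parent's §4, at the pin `w·cΛ`) and the two SCALED mixed remainder slots (§1) drop out of the tadpole; leaf-03's `combΔOfAtW_eq_sharp` supplies the split. -/
theorem tadpole_combΔAn1W_pinned_eq {cΛ : ℝ} {γ : ℕ → ℝ} (hw : ∀ j, cΛ * wM1 3 Lc j * γ j = -wM2 3 Lc j) (w : ℝ) (N j : ℕ) (α μ : Fin 4) (y : Fin 4 → ℤ)
    (ν : Fin 4) (y' : Fin 4 → ℤ) :
    tadpole (GcombSh Lc j) (combΔAn1W Lc N cΛ w γ (0 : ℕ → Fin 4 → Fin 4 → (Fin 4 → ℤ) → Fin 4 → (Fin 4 → ℤ) → (Fin 4 → ℤ) → Fib 3 → ℝ) j α μ y ν y') =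
      tadpole (GcombSh Lc j) (vertex2OfK (GcombSh (d := 3) Lc j) Lc
        (combR2An1W Lc N cΛ w γ (0 : ℕ → Fin 4 → Fin 4 → (Fin 4 → ℤ) → Fin 4 → (Fin 4 → ℤ) → (Fin 4 → ℤ) → Fib 3 → ℝ) j α) μ y ν y') := by
  have hL1 : 1 ≤ Lc := one_le_of_neZero Lc
  have hA : Spr (GcombSh (d := 3) Lc j) := spr_GcombSh (d := 3) (Lc := Lc) j
  have hM : Spr (bhKStepSh 3 Lc (Dsh Lc) j) := spr_bhKStepSh (spr_Dsh hL1) j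
  -- the letter classes at one common rate, and their existential packages
  obtain ⟨m, C, Cs, CM, Cg, hm, hC, hG, hS, hM1, hgl⟩ := comb_letters_common (Lc := Lc) (w * cΛ) γ j α
  have hK : ∃ δ C : ℝ, 0 < δ ∧ 0 ≤ C ∧ Decays (GcombSh (d := 3) Lc j) C δ := ⟨m, C, hm, hC, hG⟩
  have h𝕄 : ∃ δ C : ℝ, 0 < δ ∧ 0 ≤ C ∧ Decays (bhKStepSh 3 Lc (Dsh Lc) j) C δ := pkg_of_spr hM
  have hS' : ∃ Cs δs : ℝ, 0 < δs ∧ LocStencil (SpureRecOf 3 Lc (symVhSAt (ctr 4 Lc) 3 Lc rfl) (symHessFFAt (ctr 4 Lc) Lc) (GcombSh Lc) ((Lc : ℝ) ^ 4) (-((Lc : ℝ) ^ 8 / 2)) (w * cΛ) j) Cs δs := ⟨Cs, m, hm, hS⟩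
  have hM' : ∃ CM δM : ℝ, 0 < δM ∧ VertexFamily (M1Of 3 Lc (symHessFFAt (ctr 4 Lc) Lc) (w * cΛ) j) Lc CM δM := ⟨CM, m, hm, hM1⟩
  have hgl' : ∃ Cg δg : ℝ, 0 < δg ∧ LocStencil (fun κ u => diagK fun p a => γ j * ctGenM 3 (bhK Lc + Dsh Lc) α Lc κ u p a) Cg δg := ⟨Cg, m, hm, hgl⟩
  obtain ⟨δB, CB, hδB, hCB, hBd⟩ := pkg_of_spr (spr_add (spr_bhK (d := 3) hL1) (spr_Dsh hL1))
  have hhl : ∃ Ch δh : ℝ, 0 < δh ∧ LocStencil₂ (fun κ u κ' u' => diagK fun p a =>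
      (γ j * ctGenM 3 (bhK Lc + Dsh Lc) α Lc κ u p a) * (γ j * ctGenM 3 (bhK Lc + Dsh Lc) α Lc κ' u' p a)) Ch δh :=
    ⟨_, δB / 3, by positivity, locStencil₂_diagK_ctGenM_mul_ctGenM hBd hδB.le (γ j) (γ j) α Lc⟩
  have hR2 : ∃ C δ : ℝ, 0 < δ ∧ LocStencil₂ (combR2An1W Lc N cΛ w γ (0 : ℕ → Fin 4 → Fin 4 → (Fin 4 → ℤ) → Fin 4 → (Fin 4 → ℤ) → (Fin 4 → ℤ) → Fib 3 → ℝ) j α) C δ :=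
    locStencil₂_combR2An1W (Lc := Lc) N cΛ w γ 0 α (fun j' => sep_zeroTable (Lc := Lc) j' α) j
  -- localisation of the four surviving words
  obtain ⟨CX, δX, hδX, hXs⟩ := sep_diagK_sharpSymbol (N := Lc) hK h𝕄 hS' hM' hgl' hhl
  have hLX : Loc (diagK fun p c => (∑ κ, ∑' u, colH (GcombSh (d := 3) Lc j) Lc μ y κ u * ∑ κ', ∑' u', colH (GcombSh (d := 3) Lc j) Lc ν y' κ' u' *
      ((γ j * ctGenM 3 (bhK Lc + Dsh Lc) α Lc κ u p c) * (γ j * ctGenM 3 (bhK Lc + Dsh Lc) α Lc κ' u' p c))) +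
      ∑ κ, ∑' u, colH (K2OfK (GcombSh Lc j) Lc (SpureRecOf 3 Lc (symVhSAt (ctr 4 Lc) 3 Lc rfl) (symHessFFAt (ctr 4 Lc) Lc) (GcombSh Lc) ((Lc : ℝ) ^ 4) (-((Lc : ℝ) ^ 8 / 2)) (w * cΛ) j) (M1Of 3 Lc (symHessFFAt (ctr 4 Lc) Lc) (w * cΛ) j) ν y' +
        -(comp (comp (GcombSh Lc j) (conjV (bhKStepSh 3 Lc (Dsh Lc) j) (diagK fun p c => ∑ κ, ∑' u, colH (GcombSh Lc j) Lc ν y' κ u * (γ j * ctGenM 3 (bhK Lc + Dsh Lc) α Lc κ u p c)))) (GcombSh Lc j))) Lc μ y κ u * (γ j * ctGenM 3 (bhK Lc + Dsh Lc) α Lc κ u p c)) :=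
    ⟨_, _, _, δX, hδX, hXs μ y ν y'⟩
  have hLB : Loc (dM (-(comp (comp (GcombSh Lc j) (conjV (bhKStepSh 3 Lc (Dsh Lc) j) (diagK fun p c => ∑ κ, ∑' u, colH (GcombSh Lc j) Lc ν y' κ u * (γ j * ctGenM 3 (bhK Lc + Dsh Lc) α Lc κ u p c)))) (GcombSh Lc j))) Lc
      (SpureRecOf 3 Lc (symVhSAt (ctr 4 Lc) 3 Lc rfl) (symHessFFAt (ctr 4 Lc) Lc) (GcombSh Lc) ((Lc : ℝ) ^ 4) (-((Lc : ℝ) ^ 8 / 2)) (w * cΛ) j) (M1Of 3 Lc (symHessFFAt (ctr 4 Lc) Lc) (w * cΛ) j) μ y) :=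
    loc_dM_Xi_dressed (N := Lc) hG hC hm hM hS hM1 hgl μ y ν y'
  obtain ⟨CR, δR, hδR, hRv⟩ := sep_vertex2OfK (N := Lc) hK hR2
  have hLC₁ : Loc (vertex2OfK (GcombSh (d := 3) Lc j) Lc (combR2An1W Lc N cΛ w γ (0 : ℕ → Fin 4 → Fin 4 → (Fin 4 → ℤ) → Fin 4 → (Fin 4 → ℤ) → (Fin 4 → ℤ) → Fib 3 → ℝ) j α) μ y ν y') :=
    ⟨_, _, _, δR, hδR, hRv μ y ν y'⟩
  obtain ⟨CMx, δMx, hδMx, hMv⟩ := sep_mixOfK (N := Lc) hK (locStencilFM_smul_symRMrAn1 (Lc := Lc) w cΛ γ j α)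
  obtain ⟨CMx', δMx', hδMx', hMv'⟩ := sep_mixOfK_swap (N := Lc) hK (locStencilFM_smul_symRMrAn1 (Lc := Lc) w cΛ γ j α)
  have hLC₂ : Loc (mixOfK (GcombSh (d := 3) Lc j) Lc (fun κ u ρ t => w • symRMrAn1 Lc cΛ γ j α κ u ρ t) μ y ν y') := ⟨_, _, _, δMx, hδMx, hMv μ y ν y'⟩
  have hLC₃ : Loc (mixOfK (GcombSh (d := 3) Lc j) Lc (fun κ u ρ t => w • symRMrAn1 Lc cΛ γ j α κ u ρ t) ν y' μ y) := ⟨_, _, _, δMx', hδMx', hMv' μ y ν y'⟩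
  -- the explicit form of the defect, regrouped: (contact mismatch) + (contact-kernel vertex) + (slots)
  have e : combΔAn1W Lc N cΛ w γ (0 : ℕ → Fin 4 → Fin 4 → (Fin 4 → ℤ) → Fin 4 → (Fin 4 → ℤ) → (Fin 4 → ℤ) → Fib 3 → ℝ) j α μ y ν y' =
      combΔOfAtW Lc N cΛ w γ 0 j (combR2An1W Lc N cΛ w γ 0 j) α μ y ν y' := rfl
  have halg : ∀ (A B C D : MKer 4 (Fib 3)), A + B + C - D = (A - D) + B + C := fun _ _ _ _ => by abel
  rw [e, combΔOfAtW_eq_sharp (Lc := Lc) N cΛ w γ 0 j (Rj := combR2An1W Lc N cΛ w γ 0 j) α hR2 μ y ν y', halg, conjW_sub_conjW, diagK_zeroTable,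
    conjV_zero, sub_zero]
  -- split the tadpole and kill three of the four words
  rw [tadpole_add hA ((loc_conjV hM hLX).add hLB) (hLC₁.add (hLC₂.add hLC₃)), tadpole_add hA (loc_conjV hM hLX) hLB,
    tadpole_add hA hLC₁ (hLC₂.add hLC₃), tadpole_add hA hLC₂ hLC₃, tadpole_conjV_bhKStepSh_diagK_eq_zero j hLX,
    tadpole_dM_SpureRecOf_eq_zero (w * cΛ) j _ μ y hLB, tadpole_mixOfK_smul_symRMrAn1_eq_zero (hw j) w α μ y ν y',
    tadpole_mixOfK_smul_symRMrAn1_eq_zero (hw j) w α ν y' μ y]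
  ring

/-- [folklore] **THE κ-LITERAL's REMAINDER TADPOLE IS HALF THE SYMMETRISED T2-REMAINDER SLOT TADPOLE** (at the pin and the weight lock). -/
theorem tadpole_RmW_pinned_eq {cΛ : ℝ} {γ : ℕ → ℝ} (hw : ∀ j, cΛ * wM1 3 Lc j * γ j = -wM2 3 Lc j) (w : ℝ) (N j : ℕ) (α μ : Fin 4) (y : Fin 4 → ℤ)
    (ν : Fin 4) (y' : Fin 4 → ℤ) :
    tadpole (GcombSh Lc j)
        ((1 / 2 : ℝ) • conjV (bhKStepSh 3 Lc (Dsh Lc) j) (diagK fun p a => (0 : ℕ → Fin 4 → Fin 4 → (Fin 4 → ℤ) → Fin 4 → (Fin 4 → ℤ) → (Fin 4 → ℤ) → Fib 3 → ℝ) j α ν y' μ y p a - (0 : ℕ → Fin 4 → Fin 4 → (Fin 4 → ℤ) → Fin 4 → (Fin 4 → ℤ) → (Fin 4 → ℤ) → Fib 3 → ℝ) j α μ y ν y' p a) +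
          (1 / 2 : ℝ) • (combΔAn1W Lc N cΛ w γ (0 : ℕ → Fin 4 → Fin 4 → (Fin 4 → ℤ) → Fin 4 → (Fin 4 → ℤ) → (Fin 4 → ℤ) → Fib 3 → ℝ) j α μ y ν y' +
            combΔAn1W Lc N cΛ w γ (0 : ℕ → Fin 4 → Fin 4 → (Fin 4 → ℤ) → Fin 4 → (Fin 4 → ℤ) → (Fin 4 → ℤ) → Fib 3 → ℝ) j α ν y' μ y)) =
      (1 / 2 : ℝ) * (tadpole (GcombSh Lc j) (vertex2OfK (GcombSh (d := 3) Lc j) Lc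
          (combR2An1W Lc N cΛ w γ (0 : ℕ → Fin 4 → Fin 4 → (Fin 4 → ℤ) → Fin 4 → (Fin 4 → ℤ) → (Fin 4 → ℤ) → Fib 3 → ℝ) j α) μ y ν y') +
        tadpole (GcombSh Lc j) (vertex2OfK (GcombSh (d := 3) Lc j) Lc
          (combR2An1W Lc N cΛ w γ (0 : ℕ → Fin 4 → Fin 4 → (Fin 4 → ℤ) → Fin 4 → (Fin 4 → ℤ) → (Fin 4 → ℤ) → Fib 3 → ℝ) j α) ν y' μ y)) := by
  have hA : Spr (GcombSh (d := 3) Lc j) := spr_GcombSh (d := 3) (Lc := Lc) j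
  have hΔ := hΔL_pinnedW (Lc := Lc) N cΛ w γ
  rw [diagK_zeroTable_sub, conjV_zero, smul_zero, zero_add, tadpole_smul, tadpole_add hA (hΔ j α μ y ν y') (hΔ j α ν y' μ y),
    tadpole_combΔAn1W_pinned_eq hw w N j α μ y ν y', tadpole_combΔAn1W_pinned_eq hw w N j α ν y' μ y]

/-- [folklore] **THE κ-LITERAL's SCALAR `hRm0` FROM THE T2-REMAINDER SLOT IDENTITY ALONE** (the displayed `γ_j`, the BASE lock `hΛ : cΛ·Lc⁴ = 2`, every group weight `w`):
`hR2tad : ∀ j α μ y ν y′, tadpole G′_j (vertex2OfK G′_j Lc (combR2An1W … j α) μ y ν y′) + tadpole G′_j (vertex2OfK … ν y′ μ y) = 0` ⟹ the `hRm0` binder of leaf-04's Nw root VERBATIM. -/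
theorem hRm0W_of_hR2tad {cΛ : ℝ} (hΛ : cΛ * (Lc : ℝ) ^ 4 = 2) (w : ℝ) (N : ℕ)
    (hR2tad : ∀ (j : ℕ) (α μ : Fin 4) (y : Fin 4 → ℤ) (ν : Fin 4) (y' : Fin 4 → ℤ),
      tadpole (GcombSh Lc j) (vertex2OfK (GcombSh (d := 3) Lc j) Lc
          (combR2An1W Lc N cΛ w (fun j => -((Lc : ℝ) ^ 8 / 2) * wVH 3 Lc j / (stepScale 3 Lc j * (Lc : ℝ) ^ 4)) (0 : ℕ → Fin 4 → Fin 4 → (Fin 4 → ℤ) → Fin 4 → (Fin 4 → ℤ) → (Fin 4 → ℤ) → Fib 3 → ℝ) j α) μ y ν y') +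
        tadpole (GcombSh Lc j) (vertex2OfK (GcombSh (d := 3) Lc j) Lc
          (combR2An1W Lc N cΛ w (fun j => -((Lc : ℝ) ^ 8 / 2) * wVH 3 Lc j / (stepScale 3 Lc j * (Lc : ℝ) ^ 4)) (0 : ℕ → Fin 4 → Fin 4 → (Fin 4 → ℤ) → Fin 4 → (Fin 4 → ℤ) → (Fin 4 → ℤ) → Fib 3 → ℝ) j α) ν y' μ y) = 0) :
    ∀ (j : ℕ) (α μ : Fin 4) (y : Fin 4 → ℤ) (ν : Fin 4) (y' : Fin 4 → ℤ),
      tadpole (GcombSh Lc j)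
        ((1 / 2 : ℝ) • conjV (bhKStepSh 3 Lc (Dsh Lc) j) (diagK fun p a => (0 : ℕ → Fin 4 → Fin 4 → (Fin 4 → ℤ) → Fin 4 → (Fin 4 → ℤ) → (Fin 4 → ℤ) → Fib 3 → ℝ) j α ν y' μ y p a - (0 : ℕ → Fin 4 → Fin 4 → (Fin 4 → ℤ) → Fin 4 → (Fin 4 → ℤ) → (Fin 4 → ℤ) → Fib 3 → ℝ) j α μ y ν y' p a) +
          (1 / 2 : ℝ) • (combΔAn1W Lc N cΛ w (fun j => -((Lc : ℝ) ^ 8 / 2) * wVH 3 Lc j / (stepScale 3 Lc j * (Lc : ℝ) ^ 4)) (0 : ℕ → Fin 4 → Fin 4 → (Fin 4 → ℤ) → Fin 4 → (Fin 4 → ℤ) → (Fin 4 → ℤ) → Fib 3 → ℝ) j α μ y ν y' + combΔAn1W Lc N cΛ w (fun j => -((Lc : ℝ) ^ 8 / 2) * wVH 3 Lc j / (stepScale 3 Lc j * (Lc : ℝ) ^ 4)) (0 : ℕ → Fin 4 → Fin 4 → (Fin 4 → ℤ) → Fin 4 → (Fin 4 → ℤ) → (Fin 4 → ℤ) → Fib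 3 → ℝ) j α ν y' μ y)) = 0 := by
  intro j α μ y ν y'
  rw [tadpole_RmW_pinned_eq (fun j' => lock_of_hΛ hΛ j') w N j α μ y ν y', hR2tad j α μ y ν y', mul_zero]

end Summit.QuantumFields.BalabanUV.Beta.CombRemainderTadpoleSlotScaled

end
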